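import Literature.AnabelianGeometry.EtaleTheta.SettingModel2Theta
import Literature.AnabelianGeometry.EtaleTheta.ZHatLevelDetermination
import Literature.AnabelianGeometry.AbsoluteAnabelian.ZHatCompletionFreeProcyclic
import HarnessLib

/-!
# A model of the [EtTh] §1 root, χ-twisted reshape (R78 (B)), part F2: the `Ẑ^×`-twist `a ↦ a, b ↦ b^u`
# of `F̂₂` and its action on `Γ = F̂₂ ×_Ẑ ℤ` and on the Heisenberg levels

Mochizuki, *The étale theta function …*, Publ. RIMS **45** (2009) [EtTh], §1, PRIMS PDF p. 12
[cite: MochizukiEtTh2009, §1 p.12]: "`Δ_X` … is a profinite free group on 2 generators", "`(Ẑ(1) ≅) Δ_Θ`",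
"`(Δ^tp_Y)^ell ≅ Ẑ(1)`" (p. 13) — the Tate twists "(1)" record the CYCLOTOMIC action of `G_K` on these
cyclotomes. Layer L2 of the abc-iut cell, seat abc-iut-w5-d024 (gen 3): R78 cluster of abc-iut-L2-lead's
RULINGS #13 (file map R100), FILE F2, built OVER abc-iut-L2-t1's root model `SettingModel2Curve` /
`SettingModel2Theta` (decls `F₂hatT`, `eta`, `ZH`, `iotaZ`, `eHat`, `Gfp`, `gfpFst`, `gfpSnd`, `hHat`, `Heis`,
consumed BY NAME — nothing of another seat is edited or restated) and over the tree's `Aut(Ẑ)` vocabulary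
(`ZHatLevel.level`, `ZHatLevel.levelChar : MulAut Ẑ →* ℤ/n`, `ZHatLevel.continuous_mulEquiv`; files
`CyclotomeZHatAction`, `ZHatLevelDetermination`). Throughout, `Ẑ^× := MulAut ZH` — this IS the tree's
`Literature.IUT.HodgeArakelov.ZHatUnits` (an `abbrev` for `MulAut ZHat`, `MonoThetaCyclotomes.lean`) by `rfl`;
it is not imported here only to keep `EtaleTheta` below `IUT` in the import graph.

PURPOSE (R78 reshape (B), abc-iut-L6-d6's SHAPES 05:56:10Z): the χ-twisted model `Π^tp_X := Γ ⋊_χ G_{ℚ_p}`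
needs the action of `Ẑ^× = Aut(Ẑ)` on the free profinite group `F̂₂ = ⟨a, b⟩^` by the continuous automorphisms
`θ_u : a ↦ a, b ↦ b^u`. This file CONSTRUCTS:
* `bPow : Ẑ →ₜ* F̂₂`, `u ↦ b^u` (`ProfiniteCompletion.lift` of `k ↦ η(b)^k`), `bPow_iotaZ`;
* `twistEnd (u : Ẑ) : F̂₂ →ₜ* F̂₂`, the continuous extension of `a ↦ η a, b ↦ b^u` (`lift` along `η : F₂ → F̂₂`);
  the uniqueness principle `ext_of_eta` (continuous homomorphisms out of `F̂₂` into a Hausdorff group agreeing on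
  `η a, η b` coincide); `twistEnd_bPow` (`θ_{φ(1)} (b^t) = b^{φ t}` for `φ ∈ Aut(Ẑ)`), `twistEnd_one`,
  `twistEnd_mul` (the cocycle-free composition law);
* `twist (φ : MulAut Ẑ) : F̂₂ ≃ₜ* F̂₂` and the homomorphism `twistHom : MulAut Ẑ →* MulAut F̂₂`;
* `eHat_twist` — the twist fixes the completed `a`-exponent `ê : F̂₂ → Ẑ`, hence preserves
  `Γ = F̂₂ ×_Ẑ ℤ`: `twistGfp : MulAut Ẑ →* MulAut Γ` with `gfpFst_twistGfp`, `gfpSnd_twistGfp`,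
  `continuous_twistGfp` (inputs of F4's semidirect product `Γ ⋊_χ G_{ℚ_p}`);
* `Heis.diagTwist c : (x,y,z) ↦ (x, c·y, c·z)` and **`hHat_twist`**: on the Heisenberg levels
  `ĥ_N : F̂₂ → Heis(ℤ/N)` the twist by `φ` is `diagTwist (χ_N(φ))` with `χ_N = ZHatLevel.levelChar N` — i.e. on
  the theta quotient the twist is the scalar `χ(φ)` on the `y`- and `z`-coordinates, the cyclotomic action on
  `Δ_Θ = z`-axis that makes "`Δ_Θ ≅ Ẑ(1)`" hold in the model.
SEMI-SYNTHETIC MODEL, CONSISTENCY EVIDENCE ONLY — not the tempered fundamental group of a curve; a post-freeze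
class (b) CONSTRUCTION over the frozen interface (no interface clause touched). Nothing of [EtTh] is asserted;
no side is taken on [IUTchIII] Cor. 3.12.
-/

noncomputable section

namespace Literature.AnabelianGeometry.EtaleTheta.SettingModel

open Literature.AnabelianGeometry.SemiGraphs
open Literature.AnabelianGeometry.AbsoluteAnabelian
open CategoryTheory Function ProfiniteGrp ProfiniteGrp.ProfiniteCompletion

/-! ### Uniqueness of continuous extensions along `η : F₂ → F̂₂` -/

/-- Two continuous homomorphisms out of `F̂₂` into a Hausdorff topological group which agree on `η a` and `η b`
coincide (`η(F₂)` is dense and `F₂` is free on `a, b`). [cite: MochizukiEtTh2009, §1 p.12] -/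
theorem ext_of_eta {G : Type*} [Group G] [TopologicalSpace G] [T2Space G] {f f' : F₂hatT →ₜ* G}
    (h0 : f (eta (FreeGroup.of 0)) = f' (eta (FreeGroup.of 0)))
    (h1 : f (eta (FreeGroup.of 1)) = f' (eta (FreeGroup.of 1))) : f = f' := by
  have hF : f.toMonoidHom.comp eta = f'.toMonoidHom.comp eta := by
    refine FreeGroup.ext_hom _ _ fun i => ?_
    fin_cases i
    · exact h0
    · exact h1
  have heq : (f : F₂hatT → G) = f' :=
    denseRange_eta.equalizer f.continuous f'.continuous (funext fun g => DFunLike.congr_fun hF g)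
  exact ContinuousMonoidHom.ext fun x => congrFun heq x

/-- `ι 1 = η_Ẑ(1)`: the two spellings of `1 ∈ ℤ ⊆ Ẑ` in the tree agree. [cite: MochizukiEtTh2009, §1 p.12] -/
theorem iotaZ_one_eq : iotaZ (Multiplicative.ofAdd 1) = ZHatLevel.eta 1 := rfl

/-! ### `b^Ẑ ⊆ F̂₂` -/

/-- **`b^· : Ẑ → F̂₂`**, the continuous extension of `k ↦ η(b)^k` (`b = x₁` the second free generator).
[cite: MochizukiEtTh2009, §1 p.12] -/
def bPow : ZH →ₜ* F₂hatT :=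
  (ProfiniteGrp.ProfiniteCompletion.lift (P := F₂hat)
    (GrpCat.ofHom (zpowersHom F₂hatT (eta (FreeGroup.of 1))))).hom

/-- `b^{ι k} = η(b)^k`. [cite: MochizukiEtTh2009, §1 p.12] -/
theorem bPow_iotaZ (k : Multiplicative ℤ) :
    bPow (iotaZ k) = eta (FreeGroup.of 1) ^ (Multiplicative.toAdd k) :=
  lift_hom_toCompletion F₂hat (zpowersHom F₂hatT (eta (FreeGroup.of 1))) k

/-- `b^{ι 1} = η b`. [cite: MochizukiEtTh2009, §1 p.12] -/
theorem bPow_iotaZ_one : bPow (iotaZ (Multiplicative.ofAdd 1)) = eta (FreeGroup.of 1) := by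
  rw [bPow_iotaZ, toAdd_ofAdd, zpow_one]

/-- `ê (b^t) = 1`: the `a`-exponent of every `Ẑ`-power of `b` vanishes. [cite: MochizukiEtTh2009, §1 p.12] -/
theorem eHat_bPow (t : ZH) : eHat (bPow t) = 1 := by
  have h := ZHatCompletion.monoidHom_ext_of_continuous
    (f₁ := eHat.toMonoidHom.comp bPow.toMonoidHom) (f₂ := (1 : ZH →* ZH))
    (eHat.continuous.comp bPow.continuous) continuous_const (by
      change eHat (bPow (iotaZ (Multiplicative.ofAdd 1))) = 1
      rw [bPow_iotaZ_one, eHat_eta, expA_apply, heisHom_of_one, ofAdd_zero, map_one])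
  exact DFunLike.congr_fun h t

/-! ### The twist endomorphisms `θ_u : a ↦ a, b ↦ b^u` -/

/-- The images of the free generators under `θ_u`: `a ↦ η a`, `b ↦ b^u`. [cite: MochizukiEtTh2009, §1 p.12] -/
def twistGen (u : ZH) : Fin 2 → F₂hatT := ![eta (FreeGroup.of 0), bPow u]

/-- **`θ_u : F̂₂ → F̂₂`**, the continuous extension of `a ↦ η a, b ↦ b^u` (`u ∈ Ẑ`).
[cite: MochizukiEtTh2009, §1 p.12] -/
def twistEnd (u : ZH) : F₂hatT →ₜ* F₂hatT :=
  (ProfiniteGrp.ProfiniteCompletion.lift (P := F₂hat) (GrpCat.ofHom (FreeGroup.lift (twistGen u)))).hom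

/-- `θ_u` on `η(F₂)`. [cite: MochizukiEtTh2009, §1 p.12] -/
theorem twistEnd_eta (u : ZH) (g : F₂) : twistEnd u (eta g) = FreeGroup.lift (twistGen u) g :=
  lift_hom_toCompletion F₂hat (FreeGroup.lift (twistGen u)) g

/-- `θ_u (η a) = η a`. [cite: MochizukiEtTh2009, §1 p.12] -/
theorem twistEnd_eta_of_zero (u : ZH) : twistEnd u (eta (FreeGroup.of 0)) = eta (FreeGroup.of 0) := by
  rw [twistEnd_eta, FreeGroup.lift_apply_of]; rfl

/-- `θ_u (η b) = b^u`. [cite: MochizukiEtTh2009, §1 p.12] -/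
theorem twistEnd_eta_of_one (u : ZH) : twistEnd u (eta (FreeGroup.of 1)) = bPow u := by
  rw [twistEnd_eta, FreeGroup.lift_apply_of]; rfl

/-- **`θ_{φ(1)} (b^t) = b^{φ t}`** for `φ ∈ Aut(Ẑ)` (two continuous homomorphisms `Ẑ → F̂₂` agreeing on
`η(1)`; every automorphism of `Ẑ` is continuous, `ZHatLevel.continuous_mulEquiv`). [cite: MochizukiEtTh2009, §1 p.12] -/
theorem twistEnd_bPow (φ : MulAut ZH) (t : ZH) :
    twistEnd (φ (iotaZ (Multiplicative.ofAdd 1))) (bPow t) = bPow (φ t) := by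
  have h := ZHatCompletion.monoidHom_ext_of_continuous
    (f₁ := (twistEnd (φ (iotaZ (Multiplicative.ofAdd 1)))).toMonoidHom.comp bPow.toMonoidHom)
    (f₂ := bPow.toMonoidHom.comp φ.toMonoidHom)
    ((twistEnd _).continuous.comp bPow.continuous)
    (bPow.continuous.comp (ZHatLevel.continuous_mulEquiv φ).1) (by
      change twistEnd _ (bPow (iotaZ (Multiplicative.ofAdd 1))) = bPow (φ (iotaZ (Multiplicative.ofAdd 1)))
      rw [bPow_iotaZ_one, twistEnd_eta_of_one])
  exact DFunLike.congr_fun h t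

/-- `θ_1 = id`. [cite: MochizukiEtTh2009, §1 p.12] -/
theorem twistEnd_one :
    twistEnd ((1 : MulAut ZH) (iotaZ (Multiplicative.ofAdd 1))) = ContinuousMonoidHom.id F₂hatT := by
  refine ext_of_eta ?_ ?_
  · rw [twistEnd_eta_of_zero]; rfl
  · rw [twistEnd_eta_of_one, MulAut.one_apply, bPow_iotaZ_one]; rfl

/-- **Composition law** `θ_{(φψ)(1)} = θ_{φ(1)} ∘ θ_{ψ(1)}`. [cite: MochizukiEtTh2009, §1 p.12] -/
theorem twistEnd_mul (φ ψ : MulAut ZH) :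
    twistEnd ((φ * ψ) (iotaZ (Multiplicative.ofAdd 1))) =
      (twistEnd (φ (iotaZ (Multiplicative.ofAdd 1)))).comp (twistEnd (ψ (iotaZ (Multiplicative.ofAdd 1)))) := by
  refine ext_of_eta ?_ ?_
  · change _ = twistEnd _ (twistEnd _ (eta (FreeGroup.of 0)))
    rw [twistEnd_eta_of_zero, twistEnd_eta_of_zero, twistEnd_eta_of_zero]
  · change _ = twistEnd _ (twistEnd _ (eta (FreeGroup.of 1)))
    rw [twistEnd_eta_of_one, twistEnd_eta_of_one, twistEnd_bPow, MulAut.mul_apply]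

/-! ### The twist as automorphisms of `F̂₂`, and the homomorphism `Aut(Ẑ) → Aut(F̂₂)` -/

/-- **`θ_φ : F̂₂ ≃ₜ* F̂₂`** for `φ ∈ Aut(Ẑ) = Ẑ^×` (`a ↦ a`, `b ↦ b^{φ(1)}`; inverse `θ_{φ⁻¹}`).
[cite: MochizukiEtTh2009, §1 p.12] -/
def twist (φ : MulAut ZH) : F₂hatT ≃ₜ* F₂hatT where
  toFun := twistEnd (φ (iotaZ (Multiplicative.ofAdd 1)))
  invFun := twistEnd (φ⁻¹ (iotaZ (Multiplicative.ofAdd 1)))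
  left_inv x := by
    change (twistEnd (φ⁻¹ (iotaZ (Multiplicative.ofAdd 1)))).comp
      (twistEnd (φ (iotaZ (Multiplicative.ofAdd 1)))) x = x
    rw [← twistEnd_mul, inv_mul_cancel, twistEnd_one]; rfl
  right_inv x := by
    change (twistEnd (φ (iotaZ (Multiplicative.ofAdd 1)))).comp
      (twistEnd (φ⁻¹ (iotaZ (Multiplicative.ofAdd 1)))) x = x
    rw [← twistEnd_mul, mul_inv_cancel, twistEnd_one]; rfl
  map_mul' := map_mul _
  continuous_toFun := (twistEnd _).continuous
  continuous_invFun := (twistEnd _).continuous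

/-- `θ_φ x = θ_{φ(1)} x`. [cite: MochizukiEtTh2009, §1 p.12] -/
theorem twist_apply (φ : MulAut ZH) (x : F₂hatT) :
    twist φ x = twistEnd (φ (iotaZ (Multiplicative.ofAdd 1))) x := rfl

/-- `θ_φ (η a) = η a`. [cite: MochizukiEtTh2009, §1 p.12] -/
theorem twist_eta_of_zero (φ : MulAut ZH) : twist φ (eta (FreeGroup.of 0)) = eta (FreeGroup.of 0) :=
  twistEnd_eta_of_zero _

/-- `θ_φ (η b) = b^{φ(1)}`. [cite: MochizukiEtTh2009, §1 p.12] -/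
theorem twist_eta_of_one (φ : MulAut ZH) :
    twist φ (eta (FreeGroup.of 1)) = bPow (φ (iotaZ (Multiplicative.ofAdd 1))) :=
  twistEnd_eta_of_one _

/-- `θ_φ (b^t) = b^{φ t}`. [cite: MochizukiEtTh2009, §1 p.12] -/
theorem twist_bPow (φ : MulAut ZH) (t : ZH) : twist φ (bPow t) = bPow (φ t) := twistEnd_bPow φ t

/-- `θ_1 = id` on elements. [cite: MochizukiEtTh2009, §1 p.12] -/
theorem twist_one (x : F₂hatT) : twist 1 x = x := by
  rw [twist_apply, twistEnd_one]; rfl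

/-- `θ_{φψ} = θ_φ ∘ θ_ψ` on elements. [cite: MochizukiEtTh2009, §1 p.12] -/
theorem twist_mul (φ ψ : MulAut ZH) (x : F₂hatT) : twist (φ * ψ) x = twist φ (twist ψ x) := by
  rw [twist_apply, twistEnd_mul]; rfl

/-- **`θ : Aut(Ẑ) → Aut(F̂₂)`**, a homomorphism of groups. [cite: MochizukiEtTh2009, §1 p.12] -/
def twistHom : MulAut ZH →* MulAut F₂hatT where
  toFun φ := (twist φ).toMulEquiv
  map_one' := MulEquiv.ext fun x => twist_one x
  map_mul' φ ψ := MulEquiv.ext fun x => twist_mul φ ψ x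

/-- `twistHom φ x = θ_φ x`. [cite: MochizukiEtTh2009, §1 p.12] -/
theorem twistHom_apply (φ : MulAut ZH) (x : F₂hatT) : twistHom φ x = twist φ x := rfl

/-! ### The twist fixes `ê` and preserves `Γ = F̂₂ ×_Ẑ ℤ` -/

/-- `ê ∘ θ_u = ê`. [cite: MochizukiEtTh2009, §1 p.12] -/
theorem eHat_twistEnd (u : ZH) (x : F₂hatT) : eHat (twistEnd u x) = eHat x := by
  have h : eHat.comp (twistEnd u) = eHat := ext_of_eta
    (by change eHat (twistEnd u (eta (FreeGroup.of 0))) = _; rw [twistEnd_eta_of_zero])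
    (by
      change eHat (twistEnd u (eta (FreeGroup.of 1))) = _
      rw [twistEnd_eta_of_one, eHat_bPow, eHat_eta, expA_apply, heisHom_of_one, ofAdd_zero, map_one])
  exact DFunLike.congr_fun h x

/-- **`ê (θ_φ x) = ê x`**: the twist does not change the completed `a`-exponent. [cite: MochizukiEtTh2009, §1 p.12] -/
theorem eHat_twist (φ : MulAut ZH) (x : F₂hatT) : eHat (twist φ x) = eHat x := eHat_twistEnd _ x

/-- The twist preserves membership in `Γ = F̂₂ ×_Ẑ ℤ`. [cite: MochizukiEtTh2009, §1 p.12] -/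
theorem twist_mem_Gfp (φ : MulAut ZH) {q : F₂hatT × Multiplicative ℤ} (hq : q ∈ Gfp) :
    (twist φ q.1, q.2) ∈ Gfp := by
  rw [mem_Gfp] at hq ⊢
  change eHat (twist φ q.1) = iotaZ q.2
  rw [eHat_twist]
  exact hq

/-- The twist `θ_φ × id` restricted to `Γ`, as a group automorphism. [cite: MochizukiEtTh2009, §1 p.12] -/
def twistGfpEquiv (φ : MulAut ZH) : Gfp ≃* Gfp where
  toFun q := ⟨(twist φ (q : F₂hatT × Multiplicative ℤ).1, (q : F₂hatT × Multiplicative ℤ).2), twist_mem_Gfp φ q.2⟩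
  invFun q := ⟨(twist φ⁻¹ (q : F₂hatT × Multiplicative ℤ).1, (q : F₂hatT × Multiplicative ℤ).2),
    twist_mem_Gfp φ⁻¹ q.2⟩
  left_inv q := Subtype.ext (Prod.ext (by
    change twist φ⁻¹ (twist φ _) = _
    rw [← twist_mul, inv_mul_cancel, twist_one]) rfl)
  right_inv q := Subtype.ext (Prod.ext (by
    change twist φ (twist φ⁻¹ _) = _
    rw [← twist_mul, mul_inv_cancel, twist_one]) rfl)
  map_mul' q q' := Subtype.ext (Prod.ext (map_mul (twist φ) _ _) rfl)

/-- **`Aut(Ẑ) → Aut(Γ)`**, `φ ↦ (θ_φ × id)|_Γ` — the action through which F4's `Γ ⋊_χ G_{ℚ_p}` is formed.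
[cite: MochizukiEtTh2009, §1 p.12] -/
def twistGfp : MulAut ZH →* MulAut Gfp where
  toFun := twistGfpEquiv
  map_one' := MulEquiv.ext fun _ => Subtype.ext (Prod.ext (twist_one _) rfl)
  map_mul' φ ψ := MulEquiv.ext fun _ => Subtype.ext (Prod.ext (twist_mul φ ψ _) rfl)

/-- `twistGfp` on coordinates. [cite: MochizukiEtTh2009, §1 p.12] -/
theorem coe_twistGfp (φ : MulAut ZH) (q : Gfp) :
    ((twistGfp φ q : Gfp) : F₂hatT × Multiplicative ℤ) =
      (twist φ (q : F₂hatT × Multiplicative ℤ).1, (q : F₂hatT × Multiplicative ℤ).2) := rfl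

/-- `pr₁ ∘ twistGfp φ = θ_φ ∘ pr₁`. [cite: MochizukiEtTh2009, §1 p.12] -/
theorem gfpFst_twistGfp (φ : MulAut ZH) (q : Gfp) : gfpFst (twistGfp φ q) = twist φ (gfpFst q) := rfl

/-- `pr₂ ∘ twistGfp φ = pr₂`: the twist fixes the degree `Γ ↠ ℤ`. [cite: MochizukiEtTh2009, §1 p.12] -/
theorem gfpSnd_twistGfp (φ : MulAut ZH) (q : Gfp) : gfpSnd (twistGfp φ q) = gfpSnd q := rfl

/-- Each `twistGfp φ` is continuous. [cite: MochizukiEtTh2009, §1 p.12] -/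
theorem continuous_twistGfp (φ : MulAut ZH) : Continuous (twistGfp φ : Gfp → Gfp) := by
  refine Continuous.subtype_mk ?_ _
  exact ((twist φ).continuous.comp (continuous_fst.comp continuous_subtype_val)).prodMk
    (continuous_snd.comp continuous_subtype_val)

/-! ### The twist on the Heisenberg levels: the scalar `χ_N(φ)` on `y` and `z` -/

/-- The diagonal twist `(x, y, z) ↦ (x, c·y, c·z)` of `Heis R`, a group homomorphism for every scalar `c`
(the `x`-coordinate is untwisted). [cite: MochizukiEtTh2009, §1 p.12] -/
def Heis.diagTwist {R : Type*} [CommRing R] (c : R) : Heis R →* Heis R where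
  toFun h := ⟨h.x, c * h.y, c * h.z⟩
  map_one' := by ext <;> simp
  map_mul' a b := by ext <;> simp <;> ring

/-- [cite: MochizukiEtTh2009, §1 p.12] -/
@[simp] theorem Heis.diagTwist_apply {R : Type*} [CommRing R] (c : R) (h : Heis R) :
    Heis.diagTwist c h = ⟨h.x, c * h.y, c * h.z⟩ := rfl

/-- The diagonal twist by a UNIT `c ∈ Rˣ` as a group automorphism of `Heis R` (inverse = twist by `c⁻¹`).
[cite: MochizukiEtTh2009, §1 p.12] -/
def Heis.diagTwistEquiv {R : Type*} [CommRing R] (c : Rˣ) : Heis R ≃* Heis R where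
  toFun := Heis.diagTwist (c : R)
  invFun := Heis.diagTwist (↑c⁻¹ : R)
  left_inv h := by ext <;> simp [← mul_assoc]
  right_inv h := by ext <;> simp [← mul_assoc]
  map_mul' := map_mul _

/-- [cite: MochizukiEtTh2009, §1 p.12] -/
@[simp] theorem Heis.diagTwistEquiv_apply {R : Type*} [CommRing R] (c : Rˣ) (h : Heis R) :
    Heis.diagTwistEquiv c h = Heis.diagTwist (c : R) h := rfl

/-- Powers of an element of `Heis R` with `x = 0` are computed coordinatewise.
[cite: MochizukiEtTh2009, §1 p.12] -/
theorem Heis.pow_eq_of_x_eq_zero {R : Type*} [CommRing R] (a : Heis R) (ha : a.x = 0) (n : ℕ) :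
    a ^ n = ⟨0, (n : R) * a.y, (n : R) * a.z⟩ := by
  induction n with
  | zero => ext <;> simp
  | succ n ih =>
    rw [pow_succ, ih]
    ext <;> simp [ha] <;> ring

/-- **`ĥ_N (b^t) = (0, t mod N, 0)`**: on `b^Ẑ` the Heisenberg level map is the level-`N` character on the
`y`-axis. [cite: MochizukiEtTh2009, §1 p.12] -/
theorem hHat_bPow (N : ℕ+) (t : ZH) :
    hHat N (bPow t) = ⟨0, Multiplicative.toAdd (ZHatLevel.level N t), 0⟩ := by
  haveI : NeZero (N : ℕ) := ⟨N.ne_zero⟩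
  -- write `t = z^N · η k` with `k : ℕ`
  set k : ℕ := (Multiplicative.toAdd (ZHatLevel.level N t)).val with hkdef
  have hk : ZHatLevel.level N t = ZHatLevel.level N (ZHatLevel.eta (k : ℤ)) := by
    rw [ZHatLevel.level_eta, Int.cast_natCast, hkdef, ZMod.natCast_zmod_val, ofAdd_toAdd]
  have h1 : ZHatLevel.level N (t * (ZHatLevel.eta (k : ℤ))⁻¹) = 1 := by
    rw [map_mul, map_inv, hk, mul_inv_cancel]
  obtain ⟨z, hz⟩ := (ZHatLevel.level_eq_one_iff_exists_pow N _).mp h1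
  have ht : t = z ^ (N : ℕ) * ZHatLevel.eta (k : ℤ) := by rw [hz, inv_mul_cancel_right]
  -- the `x`-coordinate of `ĥ_N (b^z)` vanishes, so its `N`-th power is trivial
  have hx : (hHat N (bPow z)).x = 0 := hHat_x_eq_zero_of_eHat_eq_one N (eHat_bPow z)
  have hN : hHat N (bPow z) ^ (N : ℕ) = 1 := by
    rw [Heis.pow_eq_of_x_eq_zero _ hx, ZMod.natCast_self, zero_mul, zero_mul]; rfl
  -- `ĥ_N (η b ^ k) = (0, k, 0)`
  have hb : hHat N (bPow (ZHatLevel.eta (k : ℤ))) = ⟨0, (k : ZMod N), 0⟩ := by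
    change hHat N (bPow (iotaZ (Multiplicative.ofAdd (k : ℤ)))) = _
    rw [bPow_iotaZ, toAdd_ofAdd, zpow_natCast, map_pow, hHat_eta, heisHom_of_one, Heis.map_apply,
      Heis.pow_eq_of_x_eq_zero _ (by simp)]
    ext <;> simp
  rw [ht, map_mul, map_mul, map_pow, map_pow, hN, one_mul, hb, map_mul, ZHatLevel.level_pow_self,
    one_mul, ZHatLevel.level_eta, toAdd_ofAdd, Int.cast_natCast]

/-- `ĥ_N ∘ θ_{φ(1)} = diagTwist (χ_N φ) ∘ ĥ_N`. [cite: MochizukiEtTh2009, §1 p.12] -/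
theorem hHat_twistEnd (N : ℕ+) (φ : MulAut ZH) (x : F₂hatT) :
    hHat N (twistEnd (φ (iotaZ (Multiplicative.ofAdd 1))) x) =
      Heis.diagTwist (ZHatLevel.levelChar N φ) (hHat N x) := by
  -- compare the two continuous homomorphisms `F̂₂ → Heis(ℤ/N)` on `η a`, `η b`
  let D : F₂hatT →ₜ* Heis (ZMod N) :=
    { toMonoidHom := (Heis.diagTwist (ZHatLevel.levelChar N φ)).comp (hHat N).toMonoidHom
      continuous_toFun := by
        change Continuous (fun y => Heis.diagTwist (ZHatLevel.levelChar N φ) (hHat N y))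
        exact Continuous.comp (g := fun h : Heis (ZMod N) => Heis.diagTwist (ZHatLevel.levelChar N φ) h)
          continuous_of_discreteTopology (hHat N).continuous }
  have hD : ∀ y, D y = Heis.diagTwist (ZHatLevel.levelChar N φ) (hHat N y) := fun _ => rfl
  have h : (hHat N).comp (twistEnd (φ (iotaZ (Multiplicative.ofAdd 1)))) = D := by
    refine ext_of_eta ?_ ?_
    · change hHat N (twistEnd _ (eta (FreeGroup.of 0))) = D (eta (FreeGroup.of 0))
      rw [twistEnd_eta_of_zero, hD, hHat_eta, heisHom_of_zero, Heis.map_apply, Heis.diagTwist_apply]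
      ext <;> simp
    · change hHat N (twistEnd _ (eta (FreeGroup.of 1))) = D (eta (FreeGroup.of 1))
      rw [twistEnd_eta_of_one, hD, hHat_eta, heisHom_of_one, Heis.map_apply, Heis.diagTwist_apply,
        hHat_bPow, iotaZ_one_eq, ← ZHatLevel.levelChar_apply]
      ext <;> simp
  exact (DFunLike.congr_fun h x).trans (hD x)

/-- **`ĥ_N (θ_φ x) = diagTwist (χ_N φ) (ĥ_N x)`**: on the Heisenberg level `N` the twist by `φ ∈ Aut(Ẑ)` multiplies
the `y`- and `z`-coordinates by the level-`N` cyclotomic character `χ_N(φ) = ZHatLevel.levelChar N φ` and fixes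
`x` — the cyclotomic action on the theta quotient, `Δ_Θ = z`-axis `≅ Ẑ(χ)`. [cite: MochizukiEtTh2009, §1 p.12] -/
theorem hHat_twist (N : ℕ+) (φ : MulAut ZH) (x : F₂hatT) :
    hHat N (twist φ x) = Heis.diagTwist (ZHatLevel.levelChar N φ) (hHat N x) :=
  hHat_twistEnd N φ x

/-- On `Γ`: `ĥ_N (pr₁ (twistGfp φ q)) = diagTwist (χ_N φ) (ĥ_N (pr₁ q))`. [cite: MochizukiEtTh2009, §1 p.12] -/
theorem hHat_gfpFst_twistGfp (N : ℕ+) (φ : MulAut ZH) (q : Gfp) :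
    hHat N (gfpFst (twistGfp φ q)) = Heis.diagTwist (ZHatLevel.levelChar N φ) (hHat N (gfpFst q)) := by
  rw [gfpFst_twistGfp, hHat_twist]

end Literature.AnabelianGeometry.EtaleTheta.SettingModel

end
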